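import Literature.NumberTheory.Automorphic.QuaternionAlgebraAdelicFujisaki
import HarnessLib

/-!
# Fujisaki's compactness theorem for an arbitrary finite-dimensional division algebra
(Vignéras, LNM 800, Ch. III §1 Thm. 1.4, Idèles 3; Weil, *Basic Number Theory*, Ch. IV §3 Thm. 4)

Topic `NumberTheory/Automorphic`; one theorem. `QuaternionAlgebraAdelicFujisaki` proves the named
fact `AdelicGroupData.compactSpace_automorphicQuotient_units K D`, whose statement is restricted to
*quaternion* division algebras, but every input of its proof
(`exists_isCompact_mul_inclAdelic_mem`, `exists_leftModule_mul_posRealCentral_eq_one`,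
`rightModule_eq_leftModule_of_isUnit` and the discharged facts of `QuaternionAlgebraAdelicInputs`)
holds for an arbitrary finite-dimensional `K`-algebra `D` in which every non-zero element is
invertible — as in Weil's Thm. IV.4, stated for any division algebra of finite rank over a number
field (in particular for a finite field extension `E/K`). Here the assembly is redone in that
generality:

* `AdelicGroupData.compactSpace_automorphicQuotient_units_of_forall_isUnit` — for `D` a
  finite-dimensional division algebra over the number field `K` (possibly commutative, e.g.
  `D = E ⊇ K` a field), `(D ⊗ 𝔸_K)ˣ ⧸ (ℝ_{>0} · Dˣ)` is compact.

Needed for the tori `G_γ = K(γ)_𝔸^×` of the trace formula for `D^×` (Gelbart (1975), Remark 9.23: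
compactness of `Γ(γ) A \ G_γ` for regular `γ`); part of the inline (D-0026) decomposition of
`Literature.NumberTheory.Automorphic.strong_multiplicity_one_quaternionUnits`.

## References

* M.-F. Vignéras, *Arithmétique des algèbres de quaternions*, LNM 800 (1980), Ch. III §1
  Thm. 1.4 (Idèles 3, "si X est un corps") and Exercice 1.1 [VignerasLNM800].
* A. Weil, *Basic Number Theory* (1967), Ch. IV §3 Thm. 4, §4 Thm. 5 [WeilBNT1967].
* S. Gelbart, *Automorphic forms on adele groups* (1975), Remark 9.23 [Gelbart1975].
-/

noncomputable section

open NumberField IsDedekindDomain MeasureTheory Measure Topology Filter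
open scoped NNReal ENNReal Pointwise

namespace Literature.NumberTheory.Automorphic

universe u

variable (K : Type) [Field K] [NumberField K] (D : Type u) [Ring D] [Algebra K D]

/-- **Fujisaki's compactness theorem for a finite-dimensional division algebra** (Vignéras,
LNM 800, Ch. III §1 Thm. 1.4, Idèles 3: "si `X` est un corps [gauche], l'image dans `X_Aˣ/X_Kˣ` de
`Y = {x | 0 < m ≤ ‖x‖_A ≤ M}` est compacte", with Exercice 1.1; Weil, BNT Ch. IV §3 Thm. 4 for
"a division algebra of finite rank over `k`"). For a finite-dimensional `K`-algebra `D` over a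
number field in which every non-zero element is invertible, the automorphic quotient
`(D ⊗ 𝔸_K)ˣ ⧸ (ℝ_{>0} · Dˣ)` of `AdelicGroupData.units K D` is compact. Proof as in
`AdelicGroupData.compactSpace_automorphicQuotient_units_of`: rescale `x` by `t ∈ ℝ_{>0}` to left
module `1` (`exists_leftModule_mul_posRealCentral_eq_one`), use `‖·‖ᵣ = ‖·‖ₗ`
(`rightModule_eq_leftModule_of_isUnit`, valid for every division algebra) and Fujisaki's lemma
`exists_isCompact_mul_inclAdelic_mem` with `m = 1`; the quotient is then the continuous image of a
compact set. [cite: VignerasLNM800, Ch. III §1 Thm. 1.4 (Idèles 3, Fujisaki) and Exercice 1.1] -/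
theorem AdelicGroupData.compactSpace_automorphicQuotient_units_of_forall_isUnit
    [Module.Finite K D] [Nontrivial D] (hdiv : ∀ x : D, x ≠ 0 → IsUnit x) :
    CompactSpace (AdelicGroupData.units K D).automorphicQuotient := by
  haveI : LocallyCompactSpace (AdeleRing (𝓞 K) K) :=
    QuaternionAlgebraAdelicProofs.locallyCompactSpace_adeleRing K
      (compactSpace_adicCompletionIntegers_holds K)
  have hdisc : DiscreteTopology (rationalLattice K D) := discreteTopology_rationalLattice_holds K D
  have hcpt : CompactSpace (ScalarExtension K (AdeleRing (𝓞 K) K) D ⧸ rationalLattice K D) :=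
    compactSpace_quotient_rationalLattice_holds K D
  have harch : addHaar_posRealCentral_smul K D := addHaar_posRealCentral_smul_holds K D
  obtain ⟨Y, hYc, hY⟩ := exists_isCompact_mul_inclAdelic_mem K D hdiv hdisc hcpt 1 one_ne_zero
  -- every coset of `ℝ_{>0} · Dˣ` meets `Y`
  have hcov : ∀ x : adelicUnits K D, ∃ h : adelicUnits K D,
      h ∈ (AdelicGroupData.units K D).quotientSubgroup ∧ x * h ∈ Y := by
    intro x
    obtain ⟨t, ht⟩ :=
      exists_leftModule_mul_posRealCentral_eq_one K D harch Module.finrank_pos.ne' x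
    have hr : (1 : ℝ≥0)⁻¹ ≤ rightModule K D (x * posRealCentral K D t) := by
      rw [inv_one, rightModule_eq_leftModule_of_isUnit K D hdiv hdisc hcpt harch, ht]
    obtain ⟨d, hd⟩ := hY _ ht.le hr
    refine ⟨posRealCentral K D t * inclAdelic K D d, ?_, by simpa only [mul_assoc] using hd⟩
    exact Subgroup.mul_mem_sup ⟨t, rfl⟩ ⟨d, rfl⟩
  -- hence the quotient is the continuous image of the compact `Y`
  refine ⟨?_⟩
  have : (Set.univ : Set (AdelicGroupData.units K D).automorphicQuotient) =
      (AdelicGroupData.units K D).toAutomorphicQuotient '' Y := by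
    refine (Set.eq_univ_of_forall fun q => ?_).symm
    obtain ⟨x, rfl⟩ := QuotientGroup.mk_surjective q
    obtain ⟨h, hh, hxh⟩ := hcov x
    exact ⟨_, hxh, QuotientGroup.mk_mul_of_mem x hh⟩
  rw [this]
  exact hYc.image (AdelicGroupData.continuous_toAutomorphicQuotient _)

end Literature.NumberTheory.Automorphic
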